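import Mathlib.LinearAlgebra.Semisimple
import Mathlib.RingTheory.SimpleModule.WedderburnArtin
import Literature.LinearAlgebra.Matrix.CommutatorNilpotent
import Mathlib.RingTheory.Jacobson.Semiprimary
import Mathlib.RingTheory.Nilpotent.Lemmas
import HarnessLib

/-!
# The trace form is non-degenerate on the centralizer of a semisimple element (characteristic `0`)

Topic `LinearAlgebra/Matrix`; namespace `Literature.LinearAlgebra.Matrix`.  THEOREMS ONLY (no `def`, no instance, no notation, no named
fact, no `sorry`).  Written for the cell `pub/hodgecm-mathlib` (crux H413 = `stmt-HodgeConjecture-24833`, `--supports` only), LH5b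
«TAMAGAWA-DENSITY» J-side residual «`lieBallVol v x ≠ 0` at guarded `x`»: the finite-place top-form density of the centraliser
`Z(x) ⊂ U(H)(L⁺_v)` (LH5-plan (g2) memo v2, LH5-p01 (g2) D1 `Literature/NumberTheory/Weil1982/UnitaryFinCentralizerTopFormHaar`)
is non-zero exactly when the Cayley lattice `Λ₁(x)` and its trace-dual are commensurable, which rests on the NON-DEGENERACY OF THE
TRACE PAIRING `(X, Y) ↦ tr(XY)` ON THE COMMUTANT of the semisimple element `x`.  This file proves that algebraic core over any field of
characteristic `0`, in the tree's two currencies (`Module.End K V` and `Matrix n n K`); it is independent of the D1 definitions.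

THE ARGUMENT.  For a semisimple `u`, the centralizer algebra `Z(u)` is a SEMISIMPLE RING ([ArthurClozelAMS120, Ch. 1 §1 p. 4]: «`G_u` is
a semi-simple algebra, isomorphic to a product `∏ M_{nᵢ}(Fᵢ)`»; ★ `ArthurClozel.isSemisimpleRing_centralizer_of_isSemisimple`, via
`Z(u) ≅ End_{K[X]}(V_u)` and Wedderburn–Artin).  If `a ∈ Z(u)` is trace-orthogonal to `Z(u)`, then so is every left multiple `r a`
(`tr(r a b) = tr(a (b r))`), so every power of `r a` is trace-less and `r a` is nilpotent ([HornJohnson2013, 2.4.P10]: in characteristic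
`0`, `tr Aᵏ = 0` for all `k ≥ 1` forces `A` nilpotent; ★ `isNilpotent_of_forall_trace_pow_eq_zero`); an element all of whose left multiples
are nilpotent lies in the Jacobson radical (★ `ArthurClozel.mem_jacobson_of_forall_isNilpotent_mul`), which is `⊥` in a semisimple ring
(Mathlib `IsSemisimpleRing.jacobson_eq_bot`).  Hence `a = 0`.

* §1 matrix currency: `eq_zero_of_forall_trace_mul_centralizer_eq_zero` (left radical), `eq_zero_of_forall_trace_centralizer_mul_eq_zero`
  (right radical), `exists_trace_mul_ne_zero_of_mem_centralizer` (∃-form).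
* §2 endomorphism currency: `End.eq_zero_of_forall_trace_mul_centralizer_eq_zero`, `End.exists_trace_mul_ne_zero_of_mem_centralizer`.

HONEST LABEL: count-neutral infrastructure; HC_CM is proved only modulo the printed citations until rung 0 closes.

## References
* [ArthurClozelAMS120] J. Arthur, L. Clozel, *Simple algebras, base change, and the advanced theory of the trace formula*, Ann. of Math.
  Stud. 120 (1989), Ch. 1 §1 p. 4 (the centralizer of a semisimple element is a semisimple algebra `≅ ∏ M_{nᵢ}(Fᵢ)`).
* [HornJohnson2013] R. A. Horn, C. R. Johnson, *Matrix Analysis*, 2nd ed. (2013), 2.4.P10 p. 171 (`A` nilpotent iff `tr Aᵏ = 0`, `k = 1..n`).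
-/

set_option autoImplicit false

namespace Literature.LinearAlgebra.Matrix

open Module Polynomial

/-! ## §0 Two inputs re-proved privately (their ★ home `Literature/NumberTheory/Automorphic/ArthurClozelTwistedCentralizerSemisimple` is not in this
cell's build cone on the check farm; texts adapted verbatim, kept `private` so no public restatement is created) -/

section Inputs

variable {R : Type*} [Ring R]

-- adapted from ★ `Literature.NumberTheory.Automorphic.ArthurClozel.mem_jacobson_of_forall_isNilpotent_mul` (private copy)
/-- In any ring, an element all of whose left multiples are nilpotent lies in the Jacobson radical. [cite: ArthurClozelAMS120, Ch. 1 §1 p. 4] -/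
private theorem mem_jacobson_of_forall_isNilpotent_mul {x : R} (hx : ∀ r : R, IsNilpotent (r * x)) :
    x ∈ Ring.jacobson R := by
  rw [Ring.jacobson_eq_sInf_isMaximal, Submodule.mem_sInf]
  intro m hm
  by_contra hxm
  have hmax := Ideal.isMaximal_def.1 hm
  have hlt : m < m ⊔ Ideal.span {x} := by
    refine lt_of_le_of_ne le_sup_left fun h => hxm ?_
    have hx' : x ∈ m ⊔ Ideal.span {x} := Ideal.mem_sup_right (Ideal.subset_span rfl)
    rwa [← h] at hx'
  have htop : m ⊔ Ideal.span {x} = ⊤ := hmax.2 _ hlt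
  have h1 : (1 : R) ∈ m ⊔ Ideal.span {x} := htop ▸ Submodule.mem_top
  obtain ⟨a, ha, b, hb, hab⟩ := Submodule.mem_sup.1 h1
  obtain ⟨r, rfl⟩ := Ideal.mem_span_singleton'.1 hb
  have ha' : a = 1 - r * x := eq_sub_of_add_eq hab
  have hunit : IsUnit a := ha' ▸ (hx r).isUnit_one_sub
  exact hmax.1 (Ideal.eq_top_of_isUnit_mem m ha hunit)

variable {K V : Type*} [Field K] [AddCommGroup V] [Module K V]

-- adapted from ★ `Literature.NumberTheory.Automorphic.ArthurClozel.commute_aeval_of_commute` (`ArthurClozelEllipticNorm`, private copy)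
/-- An endomorphism commuting with `T` commutes with every polynomial in `T`. [cite: ArthurClozelAMS120, Ch. 1 §1 p. 4] -/
private theorem commute_aeval_of_commute {T g : Module.End K V} (hg : Commute g T) (p : K[X]) :
    Commute g (aeval T p) := by
  have hle : Algebra.adjoin K {T} ≤ Subalgebra.centralizer K {g} := by
    rw [Algebra.adjoin_le_iff, Set.singleton_subset_iff, SetLike.mem_coe,
      Subalgebra.mem_centralizer_iff]
    intro a ha
    rw [Set.mem_singleton_iff] at ha
    rw [ha]
    exact hg.eq
  have hmem : aeval T p ∈ Subalgebra.centralizer K {g} := hle (aeval_mem_adjoin_singleton K T)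
  rw [Subalgebra.mem_centralizer_iff] at hmem
  exact hmem g (Set.mem_singleton g)

-- adapted from ★ `Literature.NumberTheory.Automorphic.ArthurClozel.isSemisimpleRing_centralizer_of_isSemisimple_algEquiv` (private copy)
/-- The centralizer of a semisimple element of a `K`-algebra `A ≃ End_K(V)` (`V` finite-dimensional) is a semisimple ring: `Z(u) ≅ End_{K[X]}(V_u)` and
Wedderburn–Artin (Mathlib `IsSemisimpleRing.moduleEnd`). [cite: ArthurClozelAMS120, Ch. 1 §1 p. 4] -/
private theorem isSemisimpleRing_centralizer_of_isSemisimple_algEquiv [FiniteDimensional K V]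
    {A : Type*} [Ring A] [Algebra K A] (eA : A ≃ₐ[K] Module.End K V) (u : A)
    (hu : (eA u).IsSemisimple) :
    IsSemisimpleRing (Subalgebra.centralizer K ({u} : Set A)) := by
  set f : Module.End K V := eA u with hf
  haveI : IsSemisimpleModule K[X] (AEval' f) := hu
  haveI hE : IsSemisimpleRing (Module.End K[X] (AEval' f)) :=
    IsSemisimpleRing.moduleEnd K[X] (AEval' f)
  have hmemZ : ∀ {w : A}, w ∈ Subalgebra.centralizer K ({u} : Set A) ↔ Commute (eA w) f := by
    intro w
    rw [Subalgebra.mem_centralizer_iff]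
    simp only [Set.mem_singleton_iff, forall_eq]
    rw [hf]
    constructor
    · intro h
      show eA w * eA u = eA u * eA w
      rw [← map_mul, ← map_mul, h]
    · intro h
      apply eA.injective
      rw [map_mul, map_mul]
      exact h.eq.symm
  -- an element commuting with `u`, as a `K[X]`-linear endomorphism of `V_f`
  let Ψ : Subalgebra.centralizer K ({u} : Set A) → Module.End K[X] (AEval' f) := fun g =>
    { toFun := fun m => AEval'.of f (eA (g : A) ((AEval'.of f).symm m))
      map_add' := fun m m' => by simp only [map_add]
      map_smul' := fun p m => by
        have hc : Commute (eA (g : A)) (aeval f p) := commute_aeval_of_commute (hmemZ.1 g.2) p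
        rw [RingHom.id_apply, AEval.of_symm_smul, Module.End.smul_def, ← Module.End.mul_apply,
          hc.eq, Module.End.mul_apply, ← Module.End.smul_def (aeval f p), AEval.of_aeval_smul] }
  have hΨ : ∀ (g : Subalgebra.centralizer K ({u} : Set A)) (m : AEval' f),
      Ψ g m = AEval'.of f (eA (g : A) ((AEval'.of f).symm m)) := fun _ _ => rfl
  -- a `K[X]`-linear endomorphism of `V_f`, as an element of `A` commuting with `u`
  have hΦmem : ∀ h : Module.End K[X] (AEval' f),
      eA.symm ((AEval'.of f).symm.toLinearMap ∘ₗ h.restrictScalars K ∘ₗ (AEval'.of f).toLinearMap)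
        ∈ Subalgebra.centralizer K ({u} : Set A) := by
    intro h
    rw [hmemZ, AlgEquiv.apply_symm_apply]
    refine LinearMap.ext fun v => ?_
    simp only [Module.End.mul_apply, LinearMap.coe_comp, LinearEquiv.coe_coe, Function.comp_apply,
      LinearMap.coe_restrictScalars]
    rw [← AEval'.of_symm_X_smul, ← map_smul, AEval'.X_smul_of]
  let Φ : Module.End K[X] (AEval' f) → Subalgebra.centralizer K ({u} : Set A) := fun h =>
    ⟨eA.symm ((AEval'.of f).symm.toLinearMap ∘ₗ h.restrictScalars K ∘ₗ (AEval'.of f).toLinearMap),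
      hΦmem h⟩
  have hΦ : ∀ (h : Module.End K[X] (AEval' f)) (v : V),
      eA ((Φ h : Subalgebra.centralizer K ({u} : Set A)) : A) v = (AEval'.of f).symm (h (AEval'.of f v)) := by
    intro h v
    show eA (eA.symm _) v = _
    rw [AlgEquiv.apply_symm_apply]
    rfl
  let e : Module.End K[X] (AEval' f) ≃+* Subalgebra.centralizer K ({u} : Set A) :=
    { toFun := Φ
      invFun := Ψ
      left_inv := fun h => LinearMap.ext fun m => by
        rw [hΨ, hΦ, LinearEquiv.apply_symm_apply, LinearEquiv.apply_symm_apply]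
      right_inv := fun g => Subtype.ext (eA.injective (LinearMap.ext fun v => by
        rw [hΦ, hΨ, LinearEquiv.symm_apply_apply, LinearEquiv.symm_apply_apply]))
      map_mul' := fun h h' => Subtype.ext (eA.injective (LinearMap.ext fun v => by
        rw [Subalgebra.coe_mul, map_mul, Module.End.mul_apply, hΦ, hΦ, hΦ, Module.End.mul_apply,
          LinearEquiv.apply_symm_apply]))
      map_add' := fun h h' => Subtype.ext (eA.injective (LinearMap.ext fun v => by
        rw [Subalgebra.coe_add, map_add, LinearMap.add_apply, hΦ, hΦ, hΦ, LinearMap.add_apply,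
          map_add])) }
  exact e.isSemisimpleRing

end Inputs

/-! ## §1 Matrix currency -/

section MatrixCurrency

variable {K : Type*} [Field K] [CharZero K] {n : Type*} [Fintype n] [DecidableEq n]

/-- **The trace form is non-degenerate on the centralizer of a semisimple matrix (left radical)**: for `u ∈ M_n(K)` semisimple
(`char K = 0`) and `a ∈ Z(u)`, if `tr(a b) = 0` for every `b ∈ Z(u)` then `a = 0`.  Proof: `Z(u)` is a semisimple ring; every left multiple
`r a`, `r ∈ Z(u)`, has trace-less powers (`tr((ra)ᵏ) = tr(a · (ra)ᵏ⁻¹ r)`), hence is nilpotent, so `a ∈ Jac Z(u) = 0`.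
[cite: ArthurClozelAMS120, Ch. 1 §1 p. 4] [cite: HornJohnson2013, 2.4.P10 p. 171] -/
theorem eq_zero_of_forall_trace_mul_centralizer_eq_zero (u : Matrix n n K) (hu : Module.End.IsSemisimple (Matrix.toLin' u))
    {a : Matrix n n K} (ha : a ∈ Subalgebra.centralizer K ({u} : Set (Matrix n n K)))
    (h : ∀ b ∈ Subalgebra.centralizer K ({u} : Set (Matrix n n K)), (a * b).trace = 0) : a = 0 := by
  set C := Subalgebra.centralizer K ({u} : Set (Matrix n n K)) with hC
  haveI : IsSemisimpleRing C := isSemisimpleRing_centralizer_of_isSemisimple_algEquiv Matrix.toLinAlgEquiv' u hu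
  -- every left multiple of `a` inside `Z(u)` is nilpotent
  have hnil : ∀ r : C, IsNilpotent (r * (⟨a, ha⟩ : C)) := by
    intro r
    -- nilpotent as a matrix
    have hmat : IsNilpotent ((r : Matrix n n K) * a) := by
      refine isNilpotent_of_forall_trace_pow_eq_zero _ fun k hk _ => ?_
      obtain ⟨m, rfl⟩ := Nat.exists_eq_succ_of_ne_zero hk.ne'
      -- `((r a)^(m+1)).trace = (a * ((r a)^m * r)).trace`
      have hb : ((r : Matrix n n K) * a) ^ m * (r : Matrix n n K) ∈ C :=
        C.mul_mem (C.pow_mem (C.mul_mem r.2 ha) m) r.2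
      calc (((r : Matrix n n K) * a) ^ (m + 1)).trace
          = ((r : Matrix n n K) * (a * ((r : Matrix n n K) * a) ^ m)).trace := by
              rw [pow_succ', Matrix.mul_assoc]
        _ = ((a * ((r : Matrix n n K) * a) ^ m) * (r : Matrix n n K)).trace := Matrix.trace_mul_comm _ _
        _ = (a * (((r : Matrix n n K) * a) ^ m * (r : Matrix n n K))).trace := by rw [Matrix.mul_assoc]
        _ = 0 := h _ hb
    obtain ⟨N, hN⟩ := hmat
    refine ⟨N, Subtype.ext ?_⟩
    rw [Subalgebra.coe_pow, Subalgebra.coe_mul, Subalgebra.coe_zero]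
    exact hN
  have hjac : (⟨a, ha⟩ : C) ∈ Ring.jacobson C := mem_jacobson_of_forall_isNilpotent_mul hnil
  rw [IsSemisimpleRing.jacobson_eq_bot C, Ideal.mem_bot] at hjac
  exact congrArg Subtype.val hjac

/-- **Right-radical form**: for `u` semisimple and `a ∈ Z(u)`, if `tr(b a) = 0` for every `b ∈ Z(u)` then `a = 0` (`tr(ba) = tr(ab)`).
[cite: ArthurClozelAMS120, Ch. 1 §1 p. 4] [cite: HornJohnson2013, 2.4.P10 p. 171] -/
theorem eq_zero_of_forall_trace_centralizer_mul_eq_zero (u : Matrix n n K) (hu : Module.End.IsSemisimple (Matrix.toLin' u))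
    {a : Matrix n n K} (ha : a ∈ Subalgebra.centralizer K ({u} : Set (Matrix n n K)))
    (h : ∀ b ∈ Subalgebra.centralizer K ({u} : Set (Matrix n n K)), (b * a).trace = 0) : a = 0 :=
  eq_zero_of_forall_trace_mul_centralizer_eq_zero u hu ha fun b hb => by rw [Matrix.trace_mul_comm]; exact h b hb

/-- **∃-form**: for `u` semisimple, every non-zero `a ∈ Z(u)` pairs non-trivially with some `b ∈ Z(u)`: `tr(a b) ≠ 0`.
[cite: ArthurClozelAMS120, Ch. 1 §1 p. 4] [cite: HornJohnson2013, 2.4.P10 p. 171] -/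
theorem exists_trace_mul_ne_zero_of_mem_centralizer (u : Matrix n n K) (hu : Module.End.IsSemisimple (Matrix.toLin' u))
    {a : Matrix n n K} (ha : a ∈ Subalgebra.centralizer K ({u} : Set (Matrix n n K))) (ha0 : a ≠ 0) :
    ∃ b ∈ Subalgebra.centralizer K ({u} : Set (Matrix n n K)), (a * b).trace ≠ 0 := by
  by_contra hcon
  push Not at hcon
  exact ha0 (eq_zero_of_forall_trace_mul_centralizer_eq_zero u hu ha hcon)

/-- The centralizer condition in commutator form: `a ∈ Z(u) ↔ u * a = a * u` (Mathlib `Subalgebra.mem_centralizer_iff` at a singleton).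
[cite: ArthurClozelAMS120, Ch. 1 §1 p. 4] -/
theorem mem_centralizer_singleton_iff {R : Type*} [CommSemiring R] {A : Type*} [Semiring A] [Algebra R A] (u a : A) :
    a ∈ Subalgebra.centralizer R ({u} : Set A) ↔ u * a = a * u := by
  rw [Subalgebra.mem_centralizer_iff]
  simp only [Set.mem_singleton_iff, forall_eq]

end MatrixCurrency

/-! ## §2 Endomorphism currency -/

section EndCurrency

variable {K : Type*} [Field K] [CharZero K] {V : Type*} [AddCommGroup V] [Module K V] [FiniteDimensional K V]

/-- **The trace form is non-degenerate on the centralizer of a semisimple endomorphism** of a finite-dimensional vector space over a field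
of characteristic `0` (left radical): for `f` semisimple and `a ∈ Z(f)`, if `tr(a ∘ b) = 0` for all `b ∈ Z(f)` then `a = 0`.  Transported from
the matrix currency along `LinearMap.toMatrix` in a basis.
[cite: ArthurClozelAMS120, Ch. 1 §1 p. 4] [cite: HornJohnson2013, 2.4.P10 p. 171] -/
theorem End.eq_zero_of_forall_trace_mul_centralizer_eq_zero (f : Module.End K V) (hf : f.IsSemisimple)
    {a : Module.End K V} (ha : a ∈ Subalgebra.centralizer K ({f} : Set (Module.End K V)))
    (h : ∀ b ∈ Subalgebra.centralizer K ({f} : Set (Module.End K V)), LinearMap.trace K V (a * b) = 0) : a = 0 := by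
  classical
  set C := Subalgebra.centralizer K ({f} : Set (Module.End K V)) with hC
  haveI : IsSemisimpleRing C := isSemisimpleRing_centralizer_of_isSemisimple_algEquiv AlgEquiv.refl f hf
  let bV := Module.finBasis K V
  have hnil : ∀ r : C, IsNilpotent (r * (⟨a, ha⟩ : C)) := by
    intro r
    have hpow : ∀ k : ℕ, 0 < k → LinearMap.trace K V (((r : Module.End K V) * a) ^ k) = 0 := by
      intro k hk
      obtain ⟨m, rfl⟩ := Nat.exists_eq_succ_of_ne_zero hk.ne'
      have hb : ((r : Module.End K V) * a) ^ m * (r : Module.End K V) ∈ C :=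
        C.mul_mem (C.pow_mem (C.mul_mem r.2 ha) m) r.2
      calc LinearMap.trace K V (((r : Module.End K V) * a) ^ (m + 1))
          = LinearMap.trace K V ((r : Module.End K V) * (a * ((r : Module.End K V) * a) ^ m)) := by
              rw [pow_succ', mul_assoc]
        _ = LinearMap.trace K V ((a * ((r : Module.End K V) * a) ^ m) * (r : Module.End K V)) := LinearMap.trace_mul_comm K _ _
        _ = LinearMap.trace K V (a * (((r : Module.End K V) * a) ^ m * (r : Module.End K V))) := by rw [mul_assoc]
        _ = 0 := h _ hb
    -- nilpotent as a matrix, hence as an endomorphism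
    have hmat : IsNilpotent (LinearMap.toMatrix bV bV ((r : Module.End K V) * a)) := by
      refine isNilpotent_of_forall_trace_pow_eq_zero _ fun k hk _ => ?_
      rw [LinearMap.toMatrix_pow, ← LinearMap.trace_eq_matrix_trace K bV, hpow k hk]
    have hend : IsNilpotent ((r : Module.End K V) * a) := (LinearMap.isNilpotent_toMatrix_iff bV _).1 hmat
    obtain ⟨N, hN⟩ := hend
    refine ⟨N, Subtype.ext ?_⟩
    rw [Subalgebra.coe_pow, Subalgebra.coe_mul, Subalgebra.coe_zero]
    exact hN
  have hjac : (⟨a, ha⟩ : C) ∈ Ring.jacobson C := mem_jacobson_of_forall_isNilpotent_mul hnil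
  rw [IsSemisimpleRing.jacobson_eq_bot C, Ideal.mem_bot] at hjac
  exact congrArg Subtype.val hjac

/-- **Right-radical form** (endomorphism currency). [cite: ArthurClozelAMS120, Ch. 1 §1 p. 4] [cite: HornJohnson2013, 2.4.P10 p. 171] -/
theorem End.eq_zero_of_forall_trace_centralizer_mul_eq_zero (f : Module.End K V) (hf : f.IsSemisimple)
    {a : Module.End K V} (ha : a ∈ Subalgebra.centralizer K ({f} : Set (Module.End K V)))
    (h : ∀ b ∈ Subalgebra.centralizer K ({f} : Set (Module.End K V)), LinearMap.trace K V (b * a) = 0) : a = 0 :=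
  End.eq_zero_of_forall_trace_mul_centralizer_eq_zero f hf ha fun b hb => by rw [LinearMap.trace_mul_comm]; exact h b hb

/-- **∃-form** (endomorphism currency): a non-zero element of `Z(f)`, `f` semisimple, pairs non-trivially with `Z(f)` under the trace form.
[cite: ArthurClozelAMS120, Ch. 1 §1 p. 4] [cite: HornJohnson2013, 2.4.P10 p. 171] -/
theorem End.exists_trace_mul_ne_zero_of_mem_centralizer (f : Module.End K V) (hf : f.IsSemisimple)
    {a : Module.End K V} (ha : a ∈ Subalgebra.centralizer K ({f} : Set (Module.End K V))) (ha0 : a ≠ 0) :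
    ∃ b ∈ Subalgebra.centralizer K ({f} : Set (Module.End K V)), LinearMap.trace K V (a * b) ≠ 0 := by
  by_contra hcon
  push Not at hcon
  exact ha0 (End.eq_zero_of_forall_trace_mul_centralizer_eq_zero f hf ha hcon)

end EndCurrency

end Literature.LinearAlgebra.Matrix
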